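import Literature.MathematicalPhysics.QuantumFieldTheory.Balaban1983to89.B9Eq321ProjectionTransportZdPer
import Literature.MathematicalPhysics.QuantumFieldTheory.Balaban1983to89.B9Eq319QprimeReadingZdPer

/-!
# `Balaban1983to89.B9Eq321RofUReadingZdPer` — [Balaban1985BackgroundPropagators] (3.21)–(3.22) p. 394 AT THE FLAT BACKGROUND ON THE TORUS READ ON `ℤᵈ`:
# THE NE9 CHAIN'S `R(1)` IS THE N06 JUNCTION'S `R(1)` ON HERMITIAN DATA — bridge storey S2b, part 2: for a torus site function `u` on the fine torus of
# periods `Lᵏ·n` whose reading `read u = φ ∘ u ∘ perSite` is HERMITIAN-valued, the reading of `B9Eq326OperatorAssembly.RofU (Lᵏ) (n,…,n) φ η 1 u` (Mathlib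
# `starProjection` onto `Δ¹(ker Q′^{(Lᵏ)}(1))` in the NE9 `L²` site space) IS dag-n06-w4's `projRPer τ (Lᵏn) L k η Λs 1 (read u)` (the `formPer`-orthogonal
# projection onto `Δ¹N_𝔤^per(Q′(1))`), for the torus datum's constraint sets (`Λs k = univ`, `Λs j = ∅` below)

statement-level skeleton of published theorems with citation tags; proofs where landed; nothing here is a claim about the
Yang–Mills mass gap

`[Balaban1985BackgroundPropagators]` ("B9", CMP **99** (1985) 389–434) (3.21) p. 394 *«R(U₀) is the orthogonal projection onto Δ^η_{U₀}N(Q′), N(Q′) = {λ :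
Q′λ = 0}»*, (3.22) p. 394 *«Rf = Δ^η_Uλ₀»*, (3.23) p. 394, p. 391 *«for functions with values in N × N hermitian matrices … X·Y = tr XY … the trace is
normalized»*.  `[Balaban1985RegularSpaces]` ("B8") p. 77 (the torus datum).  PDF held: `paper:balaban1985-cmp99-background-propagators` pp. 391–394 (via the
tree's `B11Eq103H1Complex` ∕ `B9Eq321LandauProjectionZdPer` docstrings, re-read 2026-08-28).

CITATION HEADER (lean-in-tree rule).  Cell `pub-ymgap` (YM Track A, HUMAN RULINGS D-0062 ∕ D-0149), node N06 = [B9], width seat `pub-ymgap-dag-n06-w3` (g6),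
bridge storey S2b part 2 (LOCATED-BRIDGE bus 2026-08-28 14:27Z; memo `HOME/pub-ymgap-dag-n06-w3/BRIDGE-NE9-PERIODIC-g6.md`).  WHY.  With S1 (carriers and the
`D`-letters, p641671), S4-fibre (`φ`), S2a (transport of projections; the NE9 pairing in trace currency; the flat Laplacian reading) and S2b part 1 (the
`N(Q′)`-match), the `R`-LETTER of the NE9 chain's flat principal operator `D*D + D R(1) D* + aQ(1)†Q(1)` and the `R`-letter of the N06 junction's periodic
genuine record (`opsLandauPer`'s `DRDs := D·projRPer·D*`, dag-n06-b CLAIM-3) can be IDENTIFIED at the flat background.  The one mathematical point: NE9's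
`ker Q′` is a COMPLEX subspace of `W`-valued functions while `gaugeNullPer` consists of HERMITIAN-valued ones; on Hermitian data the two projections agree
because the fibre-wise adjoint `S : u ↦ φ⁻¹((φu)*)` is an anti-unitary involution of the NE9 space for a TRACIAL `τ` (`⟨Su, Sv⟩ = ⟨v, u⟩`) preserving
`Δ¹(ker Q′(1))`, hence commuting with the orthogonal projection (§1), so the projection of Hermitian data has a Hermitian, `Q′(1)`-null potential (§3).

WHAT IS PROVED (kernel, 0 sorry, 0 def; [folklore] linear algebra + the letter bookkeeping — the cited sentences are print's definitions).
* §1 ★ `starProjection_map_of_antiunitary` (an additive involution `S` with `⟨Su, Sv⟩ = ⟨v, u⟩` preserving `K` commutes with `K.starProjection`).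
* §2 ★ `QprimeIter_one_map` (the flat `k`-fold block mean commutes with every real-linear fibre map), `covLap_one_map` (so does the flat Laplacian stencil),
  `QprimeIter_one_hermPart ∕ QprimeIter_one_star ∕ covLap_one_hermPart`.
* §3 ★★★ `read_RofU_one_eq_projRPer` (THE `R`-LETTER IDENTITY: `read (RofU (Lᵏ) (fun _ => n) φ η 1 u) = projRPer τ (Lᵏ·n) L k η Λs 1 (read u)` for `read u`
  Hermitian, `Λs k = univ`, `Λs j = ∅` for `j < k`, `τ` tracial Hermitian faithful, `φ` τ-isometric, `1 ≤ L`).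

HONEST SCOPE.  Count-neutral helper (`--supports` the K1 item of record): an identity between two typings of print's (3.21) at `U₀ = 1`; NO estimate; the
`Q`-letter (S3) and the import of (1.90) (S4) are open; Thm 3.11 ∕ 3.3 NOT proved; N05 ∕ N06 NOT discharged; K1 NOT closed; one finite `𝕋⁴` programme at fixed
`ε`, Bałaban as printed; R4 closes only the conditional finite-`𝕋⁴` rung `BalabanLadder.UV` — nothing continuum ∕ ℝ⁴ ∕ OS ∕ mass gap ∕ Clay.  Unit
`pub-ymgap-dag-n06-w3` (g6), 2026-08-28; NEW file importing `B9Eq321ProjectionTransportZdPer` and `B9Eq319QprimeReadingZdPer`; modifies nothing.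
Net new unproved facts: 0.
-/

noncomputable section

open scoped BigOperators InnerProductSpace ComplexConjugate

namespace Literature.MathematicalPhysics.QuantumFieldTheory.Balaban1983to89.B9Eq321RofUReadingZdPer

open B4Sect5Torus (TSite)
open B9SectCLatticeCarrier (Bond)
open B9Eq311L2Pairing (WL2)
open B11Eq103H1Complex (SiteL2K covLaplaceSiteK projR RLatticeK)
open B9Eq315QTorus (perSite)
open B9Eq315QTorusOnto (liftSite perSite_liftSite)
open B9Eq319QprimeTorus (fineP)
open B9Eq326OperatorAssembly (QprimeW RofU)
open B9Eq310HessianOperator (adTransportW)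
open B5Eq172HodgePositivity (adTransportW_one)
open B7Prop2Explicit (unitaryUnits)
open B7Eq78Linearization (QprimeIter zdBlocking)
open B7Eq214FlatQprime (QprimeIter_one_eq_sum_blockSites)
open B8Eq119TwistedAxial (bgT bgT_one)
open B8Eq138LandauZd (covLap)
open B8Eq191FlatStencils (covLap_flat_apply)
open Literature.MathematicalPhysics.QuantumLattice (blockSites)
open T4TermwiseTorus (IsPeriodic box)
open B9Eq327GreenZdHerm (hermPart hermPart_of_isSelfAdjoint isSelfAdjoint_hermPart hermPart_add hermPart_smul)
open B9Eq321LandauProjectionZd (trForm trForm_apply star_covLap)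
open B9Eq321LandauProjectionZdPer (perSub perRestrict perRestrict_eq_self perRestrict_mem_perSub formPer formPer_apply gaugeNullPer rangeGenPer rangeSubPer
  projEPer projRPer covLap_mem_perSub covLap_mem_rangeGenPer isCompl_rangeSubPer_orthogonal projEPer_eq_projection)
open B9Eq315PeriodicReadingZdPer (isPeriodic_comp_perSite_const comp_perSite_liftSite_restrict periodVec_const)
open B9Eq321ProjectionTransportZdPer (map_starProjection_eq_projection_span re_inner_siteL2K_eq_mul_trForm read_covLaplaceSiteK_flat)
open B9Eq319QprimeReadingZdPer (QprimeW_one_pow_eq_zero_iff)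

variable {d : ℕ}

/-! ## §1  An anti-unitary involution preserving `K` commutes with the orthogonal projection onto `K` -/

section AntiUnitary

variable {E : Type*} [NormedAddCommGroup E] [InnerProductSpace ℂ E] [FiniteDimensional ℂ E]

/-- ★ **AN ANTI-UNITARY INVOLUTION PRESERVING `K` COMMUTES WITH THE ORTHOGONAL PROJECTION ONTO `K`**: if `S : E → E` is additive (here: respects differences),
involutive, satisfies `⟨Su, Sv⟩ = ⟨v, u⟩`, and maps `K` into itself, then `P_K(Su) = S(P_K u)` — `S(P_K u) ∈ K` and `Su − S(P_K u) = S(u − P_K u) ⊥ K`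
(«R(U₀) is the orthogonal projection», (3.21); the involution is the fibre-wise Hermitian adjoint, anti-unitary for a tracial pairing, p. 391).
[cite: Balaban1985BackgroundPropagators, (3.21) p.394, p.391] -/
theorem starProjection_map_of_antiunitary (K : Submodule ℂ E) (S : E → E) (hSK : ∀ v ∈ K, S v ∈ K) (hSS : ∀ v, S (S v) = v)
    (hSsub : ∀ f g, S (f - g) = S f - S g) (hSinner : ∀ f g, ⟪S f, S g⟫_ℂ = ⟪g, f⟫_ℂ) (u : E) :
    K.starProjection (S u) = S (K.starProjection u) := by
  refine K.eq_starProjection_of_mem_of_inner_eq_zero (hSK _ (K.starProjection_apply_mem u)) fun w hw => ?_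
  rw [← hSsub, ← hSS w, hSinner]
  exact Submodule.inner_right_of_mem_orthogonal (hSK w hw) (K.sub_starProjection_mem_orthogonal u)

end AntiUnitary

/-! ## §2  The flat block mean and the flat Laplacian commute with real-linear fibre maps -/

section FibreMaps

variable {𝔸 : Type*} [CStarAlgebra 𝔸] (L : ℕ) (k : ℕ) (η : ℝ)

/-- ★ **THE FLAT `k`-FOLD BLOCK MEAN COMMUTES WITH EVERY REAL-LINEAR FIBRE MAP** (it is a real-linear combination of point evaluations,
`B7Eq214FlatQprime.QprimeIter_one_eq_sum_blockSites`). [cite: Balaban1985BackgroundPropagators, (3.19) p.393; Balaban1985Averaging, (212) p.50] -/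
theorem QprimeIter_one_map (hL : 1 ≤ L) (g : 𝔸 →ₗ[ℝ] 𝔸) (f : B7Prop1Explicit.Site d → 𝔸) (z : B7Prop1Explicit.Site d) :
    QprimeIter (zdBlocking d L) (bgT L (1 : B7Prop1Explicit.Site d → Fin d → 𝔸ˣ)) k (fun x => g (f x)) z =
      g (QprimeIter (zdBlocking d L) (bgT L (1 : B7Prop1Explicit.Site d → Fin d → 𝔸ˣ)) k f z) := by
  rw [bgT_one, QprimeIter_one_eq_sum_blockSites hL, QprimeIter_one_eq_sum_blockSites hL, map_sum]
  refine Finset.sum_congr rfl fun x _ => ?_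
  rw [map_smul]

/-- **THE FLAT LAPLACIAN STENCIL COMMUTES WITH EVERY REAL-LINEAR FIBRE MAP**. [cite: Balaban1985BackgroundPropagators, (3.23) p.394] -/
theorem covLap_one_map (g : 𝔸 →ₗ[ℝ] 𝔸) (f : B7Prop1Explicit.Site d → 𝔸) (x : B7Prop1Explicit.Site d) :
    covLap η (1 : B7Prop1Explicit.Site d → Fin d → 𝔸ˣ) (fun z => g (f z)) x = g (covLap η (1 : B7Prop1Explicit.Site d → Fin d → 𝔸ˣ) f x) := by
  rw [covLap_flat_apply, covLap_flat_apply, map_sum]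
  refine Finset.sum_congr rfl fun ν _ => ?_
  simp only [map_smul, map_sub]

/-- the flat `k`-fold block mean commutes with the Hermitian part. [cite: Balaban1985BackgroundPropagators, (3.19) p.393, p.391] -/
theorem QprimeIter_one_hermPart (hL : 1 ≤ L) (f : B7Prop1Explicit.Site d → 𝔸) (z : B7Prop1Explicit.Site d) :
    QprimeIter (zdBlocking d L) (bgT L (1 : B7Prop1Explicit.Site d → Fin d → 𝔸ˣ)) k (fun x => hermPart (f x)) z =
      hermPart (QprimeIter (zdBlocking d L) (bgT L (1 : B7Prop1Explicit.Site d → Fin d → 𝔸ˣ)) k f z) :=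
  QprimeIter_one_map L k hL ⟨⟨hermPart, hermPart_add⟩, hermPart_smul⟩ f z

/-- the flat `k`-fold block mean commutes with the fibre adjoint. [cite: Balaban1985BackgroundPropagators, (3.19) p.393, p.391] -/
theorem QprimeIter_one_star (hL : 1 ≤ L) (f : B7Prop1Explicit.Site d → 𝔸) (z : B7Prop1Explicit.Site d) :
    QprimeIter (zdBlocking d L) (bgT L (1 : B7Prop1Explicit.Site d → Fin d → 𝔸ˣ)) k (fun x => star (f x)) z =
      star (QprimeIter (zdBlocking d L) (bgT L (1 : B7Prop1Explicit.Site d → Fin d → 𝔸ˣ)) k f z) := by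
  rw [bgT_one, QprimeIter_one_eq_sum_blockSites hL, QprimeIter_one_eq_sum_blockSites hL, star_sum]
  refine Finset.sum_congr rfl fun x _ => ?_
  rw [star_smul]
  congr 1

/-- the flat Laplacian stencil commutes with the Hermitian part. [cite: Balaban1985BackgroundPropagators, (3.23) p.394, p.391] -/
theorem covLap_one_hermPart (f : B7Prop1Explicit.Site d → 𝔸) (x : B7Prop1Explicit.Site d) :
    covLap η (1 : B7Prop1Explicit.Site d → Fin d → 𝔸ˣ) (fun z => hermPart (f z)) x =
      hermPart (covLap η (1 : B7Prop1Explicit.Site d → Fin d → 𝔸ˣ) f x) :=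
  covLap_one_map η ⟨⟨hermPart, hermPart_add⟩, hermPart_smul⟩ f x

end FibreMaps

/-! ## §3  The `R`-letter identity on Hermitian data -/

section Main

variable (L : ℕ) [NeZero L] (k n : ℕ) [NeZero n] {𝔸 : Type*} [CStarAlgebra 𝔸] [FiniteDimensional ℝ 𝔸]
  (τ : 𝔸 →ₗ[ℂ] ℂ) {n' : ℕ} {c₀ : ℝ} [Fact (0 < c₀)] (η : ℝ)
  (φ : EuclideanSpace ℂ (Fin n') ≃ₗ[ℂ] 𝔸)

/-- ★★★ **THE `R`-LETTER IDENTITY AT THE FLAT BACKGROUND ON HERMITIAN DATA** ([B9] (3.21)–(3.22) typed twice): for a site function `u` of the NE9 `L²` space on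
the fine torus of periods `Lᵏ·n` (fibre `W = EuclideanSpace ℂ (Fin n)` read in `𝔸` by a τ-isometric `φ`) whose reading `x ↦ φ(u(x̄))` is HERMITIAN-valued,
the reading of `R^{(Lᵏ)}(1)u` (`B9Eq326OperatorAssembly.RofU (Lᵏ) (fun _ => n) φ η 1`, the orthogonal projection onto `Δ¹(ker Q′^{(Lᵏ)}(1))`) is dag-n06-w4's
`projRPer τ (Lᵏn) L k η Λs 1` of the reading, for the torus datum's constraint sets `Λs k = univ`, `Λs j = ∅` (`j < k`); `τ` tracial, Hermitian and
faithful, `1 ≤ L`. [cite: Balaban1985BackgroundPropagators, (3.21)–(3.22) p.394, (3.23) p.394, p.391; Balaban1985RegularSpaces, p.77] -/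
theorem read_RofU_one_eq_projRPer (hτs : ∀ a : 𝔸, τ (star a) = starRingEnd ℂ (τ a)) (hτp : ∀ a : 𝔸, a ≠ 0 → 0 < (τ (star a * a)).re)
    (hτt : ∀ a b : 𝔸, τ (a * b) = τ (b * a)) (hφ : ∀ x y : EuclideanSpace ℂ (Fin n'), τ (star (φ x) * φ y) = ⟪x, y⟫_ℂ) (hL : 1 ≤ L)
    (Λs : ℕ → Set (B7Prop1Explicit.Site d)) (hΛk : Λs k = Set.univ) (hΛlt : ∀ j, j < k → Λs j = ∅)
    (u : SiteL2K ℂ d (fineP (L ^ k) (fun _ : Fin d => n)) c₀ (EuclideanSpace ℂ (Fin n')))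
    (hHerm : ∀ x : B7Prop1Explicit.Site d,
      IsSelfAdjoint (φ (WL2.equiv ℂ _ _ u (perSite (fineP (L ^ k) (fun _ : Fin d => n)) x)))) :
    (fun x => φ (WL2.equiv ℂ _ _ (RofU (L ^ k) (fun _ : Fin d => n) φ η (fun _ => (1 : 𝔸ˣ)) u) (perSite (fineP (L ^ k) (fun _ : Fin d => n)) x))) =
      projRPer τ (L ^ k * n) L k η Λs (1 : B7Prop1Explicit.Site d → Fin d → 𝔸ˣ)
        (fun x => φ (WL2.equiv ℂ _ _ u (perSite (fineP (L ^ k) (fun _ : Fin d => n)) x))) := by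
  classical
  -- NOTATION (proof-local): the fine periods, the NE9 site space, the reading, the letters
  set P : ℕ := L ^ k * n with hPdef
  haveI hP0 : NeZero P := ⟨mul_ne_zero (pow_ne_zero k (NeZero.ne L)) (NeZero.ne n)⟩
  have hfine : fineP (L ^ k) (fun _ : Fin d => n) = fun _ : Fin d => P := rfl
  haveI : FiniteDimensional ℂ 𝔸 := Module.Finite.of_restrictScalars_finite ℝ ℂ 𝔸
  let E := SiteL2K ℂ d (fineP (L ^ k) (fun _ : Fin d => n)) c₀ (EuclideanSpace ℂ (Fin n'))
  set rd : E → (B7Prop1Explicit.Site d → 𝔸) := fun f x => φ (WL2.equiv ℂ _ _ f (perSite (fineP (L ^ k) (fun _ : Fin d => n)) x))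
    with hrd_def
  have hrd : ∀ (f : E) (x : B7Prop1Explicit.Site d), rd f x = φ (WL2.equiv ℂ _ _ f (perSite (fineP (L ^ k) (fun _ : Fin d => n)) x)) :=
    fun _ _ => by rw [hrd_def]
  -- the reading is periodic, additive, real-homogeneous and injective
  have hrd_per : ∀ f : E, IsPeriodic P (rd f) := fun f => by
    rw [hrd_def]; exact isPeriodic_comp_perSite_const P (fun y => φ (WL2.equiv ℂ _ _ f y))
  have hrd_sub : ∀ f g : E, rd (f - g) = fun x => rd f x - rd g x := fun f g => by
    funext x; rw [hrd, hrd, hrd, WL2.equiv_sub, Pi.sub_apply, map_sub]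
  have hrd_add : ∀ f g : E, rd (f + g) = fun x => rd f x + rd g x := fun f g => by
    funext x; rw [hrd, hrd, hrd, WL2.equiv_add, Pi.add_apply, map_add]
  have hrd_smul : ∀ (r : ℝ) (f : E), rd (r • f) = fun x => r • rd f x := fun r f => by
    funext x; rw [hrd, hrd, WL2.equiv_smul, Pi.smul_apply, ← Complex.coe_smul, map_smul, Complex.coe_smul]
  have hrd_inj : ∀ f g : E, rd f = rd g → f = g := by
    intro f g h
    apply (WL2.equiv ℂ (fun _ : TSite d (fineP (L ^ k) (fun _ : Fin d => n)) => c₀) (EuclideanSpace ℂ (Fin n'))).injective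
    funext y
    apply φ.injective
    have hy := congr_fun h (liftSite y)
    rw [hrd, hrd, perSite_liftSite] at hy
    exact hy
  -- the fibre-wise adjoint `S`
  let S : E → E := fun f => (WL2.equiv ℂ _ _).symm fun y => φ.symm (star (φ (WL2.equiv ℂ _ _ f y)))
  have hS_apply : ∀ (f : E) (y : TSite d (fineP (L ^ k) (fun _ : Fin d => n))),
      WL2.equiv ℂ _ _ (S f) y = φ.symm (star (φ (WL2.equiv ℂ _ _ f y))) := fun _ _ => rfl
  have hrdS : ∀ f : E, rd (S f) = fun x => star (rd f x) := fun f => by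
    funext x; rw [hrd, hS_apply, LinearEquiv.apply_symm_apply]
  have hSS : ∀ f : E, S (S f) = f := fun f => by
    apply hrd_inj; rw [hrdS, hrdS]; funext x; exact star_star _
  have hSsub : ∀ f g : E, S (f - g) = S f - S g := fun f g => by
    apply hrd_inj; rw [hrdS, hrd_sub, hrd_sub, hrdS, hrdS]; funext x; exact star_sub _ _
  have hSinner : ∀ f g : E, ⟪S f, S g⟫_ℂ = ⟪g, f⟫_ℂ := by
    intro f g
    rw [WL2.inner_def, WL2.inner_def]
    refine Finset.sum_congr rfl fun y _ => ?_
    rw [hS_apply, hS_apply, ← hφ, ← hφ, LinearEquiv.apply_symm_apply, LinearEquiv.apply_symm_apply, star_star, hτt]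
  -- the NE9 flat letters: Laplacian `Δs` and averaging `Q′`
  let Δs : E →ₗ[ℂ] E := covLaplaceSiteK (((η : ℂ))⁻¹)
    (adTransportW φ fun _ : Bond d (fineP (L ^ k) (fun _ : Fin d => n)) => (1 : 𝔸ˣ))
    (adTransportW φ fun b : Bond d (fineP (L ^ k) (fun _ : Fin d => n)) => ((fun _ => (1 : 𝔸ˣ)) b)⁻¹)
  let Q' := QprimeW (L ^ k) (fun _ : Fin d => n) φ (fun _ : Bond d (fineP (L ^ k) (fun _ : Fin d => n)) => (1 : 𝔸ˣ)) (c₀ := c₀)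
  have hT1 : (adTransportW φ fun _ : Bond d (fineP (L ^ k) (fun _ : Fin d => n)) => (1 : 𝔸ˣ)) = fun _ => LinearMap.id :=
    funext fun b => adTransportW_one φ b
  have hT2 : (adTransportW φ fun b : Bond d (fineP (L ^ k) (fun _ : Fin d => n)) => ((fun _ => (1 : 𝔸ˣ)) b)⁻¹) = fun _ => LinearMap.id := by
    have : (fun b : Bond d (fineP (L ^ k) (fun _ : Fin d => n)) => ((fun _ => (1 : 𝔸ˣ)) b)⁻¹) = fun _ => (1 : 𝔸ˣ) := funext fun _ => inv_one
    rw [this]; exact funext fun b => adTransportW_one φ b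
  have hΔs_eq : Δs = covLaplaceSiteK (((η⁻¹ : ℝ) : ℂ)) (fun _ => LinearMap.id) (fun _ => LinearMap.id) := by
    show covLaplaceSiteK _ _ _ = _
    rw [hT1, hT2, Complex.ofReal_inv]
  -- the flat Laplacian read on `ℤᵈ`
  have hrdΔ : ∀ f : E, rd (Δs f) = covLap η (1 : B7Prop1Explicit.Site d → Fin d → 𝔸ˣ) (rd f) := fun f => by
    funext x; rw [hrd, hΔs_eq, read_covLaplaceSiteK_flat]
  -- `S` commutes with `Δs` and preserves `ker Q′`
  have hunit1 : ∀ (x : B7Prop1Explicit.Site d) (κ : Fin d), (1 : B7Prop1Explicit.Site d → Fin d → 𝔸ˣ) x κ ∈ unitaryUnits 𝔸 :=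
    fun _ _ => (unitaryUnits 𝔸).one_mem
  have hSΔ : ∀ f : E, S (Δs f) = Δs (S f) := fun f => by
    apply hrd_inj
    rw [hrdS, hrdΔ, hrdΔ, hrdS]
    funext x
    exact star_covLap η hunit1 (rd f) x
  have hQiff : ∀ f : E, Q' f = 0 ↔ ∀ z, QprimeIter (zdBlocking d L) (bgT L (1 : B7Prop1Explicit.Site d → Fin d → 𝔸ˣ)) k (rd f) z = 0 :=
    fun f => QprimeW_one_pow_eq_zero_iff L k n φ hL f
  have hSQ : ∀ f : E, Q' f = 0 → Q' (S f) = 0 := fun f hf => by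
    rw [hQiff] at hf ⊢
    intro z
    rw [hrdS, QprimeIter_one_star L k hL (rd f) z, hf z, star_zero]
  -- the NE9 range `V = Δ¹(ker Q′)` is `S`-invariant, and `R(1) = P_V`
  let V : Submodule ℂ E := (LinearMap.ker Q').map Δs
  have hSV : ∀ v ∈ V, S v ∈ V := by
    rintro v ⟨l, hl, rfl⟩
    exact ⟨S l, LinearMap.mem_ker.2 (hSQ l (LinearMap.mem_ker.1 hl)), (hSΔ l).symm⟩
  have hR : ∀ f : E, RofU (L ^ k) (fun _ : Fin d => n) φ η (fun _ => (1 : 𝔸ˣ)) f = V.starProjection f := fun f => rfl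
  -- `S u = u`, hence `S (P u) = P u` and `rd (P u)` is Hermitian
  have hSu : S u = u := by
    apply hrd_inj; rw [hrdS]; funext x; exact (hHerm x).star_eq
  have hPS : S (V.starProjection u) = V.starProjection u := by
    rw [← starProjection_map_of_antiunitary V S hSV hSS hSsub hSinner u, hSu]
  have hPherm : ∀ x, IsSelfAdjoint (rd (V.starProjection u) x) := fun x => by
    have h := congr_fun (hrdS (V.starProjection u)) x
    rw [hPS] at h
    exact h.symm
  -- a Hermitian `Q′(1)`-null potential of `P u`
  obtain ⟨l₀, hl₀, hPu⟩ : ∃ l₀ ∈ LinearMap.ker Q', Δs l₀ = V.starProjection u := Submodule.mem_map.1 (V.starProjection_apply_mem u)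
  let lam₀ : B7Prop1Explicit.Site d → 𝔸 := fun x => hermPart (rd l₀ x)
  have hlam₀Δ : covLap η (1 : B7Prop1Explicit.Site d → Fin d → 𝔸ˣ) lam₀ = rd (V.starProjection u) := by
    funext x
    show covLap η 1 (fun z => hermPart (rd l₀ z)) x = _
    rw [covLap_one_hermPart, ← congr_fun (hrdΔ l₀) x, hPu, hermPart_of_isSelfAdjoint (hPherm x)]
  have hlam₀N : lam₀ ∈ gaugeNullPer P L k Λs (1 : B7Prop1Explicit.Site d → Fin d → 𝔸ˣ) := by
    refine ⟨fun x => isSelfAdjoint_hermPart _, fun x m => ?_, fun j hj y hy => ?_⟩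
    · exact congrArg hermPart (hrd_per l₀ x m)
    · rcases lt_or_eq_of_le hj with hjk | rfl
      · rw [hΛlt j hjk] at hy; exact absurd hy (Set.notMem_empty y)
      · have h0 : ∀ z, QprimeIter (zdBlocking d L) (bgT L (1 : B7Prop1Explicit.Site d → Fin d → 𝔸ˣ)) j (rd l₀) z = 0 :=
          (hQiff l₀).1 (LinearMap.mem_ker.1 hl₀)
        show QprimeIter (zdBlocking d L) (bgT L 1) j (fun x => hermPart (rd l₀ x)) y = 0
        rw [QprimeIter_one_hermPart L j hL, h0 y, B9Eq327GreenZdHerm.hermPart_zero]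
  -- the reading as a real-linear map into `perSub P` and its pairing
  let Ψ : E →ₗ[ℝ] perSub (𝔸 := 𝔸) (d := d) P :=
    { toFun := fun f => ⟨rd f, hrd_per f⟩
      map_add' := fun f g => Subtype.ext (hrd_add f g)
      map_smul' := fun r f => Subtype.ext (hrd_smul r f) }
  have hΨ_apply : ∀ f : E, ((Ψ f : perSub (𝔸 := 𝔸) (d := d) P) : B7Prop1Explicit.Site d → 𝔸) = rd f := fun _ => rfl
  have hΨ : ∀ f g : E, formPer τ P (Ψ f) (Ψ g) = c₀⁻¹ * RCLike.re ⟪f, g⟫_ℂ := fun f g => by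
    rw [formPer_apply, hΨ_apply, hΨ_apply, re_inner_siteL2K_eq_mul_trForm P τ φ hφ f g, ← mul_assoc,
      inv_mul_cancel₀ (ne_of_gt (Fact.out : (0 : ℝ) < c₀)), one_mul, trForm_apply]
  -- every generator of `rangeSubPer` is read from `V`
  have hG : ∀ g ∈ rangeGenPer P L k η Λs (1 : B7Prop1Explicit.Site d → Fin d → 𝔸ˣ), ∃ v ∈ V, Ψ v = g := by
    rintro g ⟨lam, hlam, hg⟩
    -- the torus site function whose reading is `λ`
    let l : E := (WL2.equiv ℂ _ _).symm fun y => φ.symm (lam (liftSite y))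
    have hrdl : rd l = lam := by
      funext x
      rw [hrd]
      show φ (φ.symm (lam (liftSite (perSite (fineP (L ^ k) (fun _ : Fin d => n)) x)))) = lam x
      rw [LinearEquiv.apply_symm_apply]
      exact comp_perSite_liftSite_restrict P hlam.2.1 x
    have hlker : l ∈ LinearMap.ker Q' := by
      rw [LinearMap.mem_ker, hQiff, hrdl]
      intro z
      exact hlam.2.2 k le_rfl z (by rw [hΛk]; exact Set.mem_univ z)
    refine ⟨Δs l, ⟨l, hlker, rfl⟩, Subtype.ext ?_⟩
    rw [hΨ_apply, hrdΔ, hrdl, hg]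
  -- `Ψ (P u)` lies in `rangeSubPer`
  have hu : Ψ (V.starProjection u) ∈ Submodule.span ℝ (rangeGenPer P L k η Λs (1 : B7Prop1Explicit.Site d → Fin d → 𝔸ˣ)) := by
    refine Submodule.subset_span ⟨lam₀, hlam₀N, ?_⟩
    rw [hΨ_apply, hlam₀Δ]
  -- transport the projection
  have hmain := map_starProjection_eq_projection_span (formPer τ P) Ψ c₀⁻¹ hΨ V
    (rangeGenPer P L k η Λs (1 : B7Prop1Explicit.Site d → Fin d → 𝔸ˣ)) hG (isCompl_rangeSubPer_orthogonal L k η Λs 1 hτs hτp) u hu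
  -- read both sides
  have hper_u : IsPeriodic P (fun x => φ (WL2.equiv ℂ _ _ u (perSite (fineP (L ^ k) (fun _ : Fin d => n)) x))) := hrd_per u
  have hsub : (⟨perRestrict P (fun x => φ (WL2.equiv ℂ _ _ u (perSite (fineP (L ^ k) (fun _ : Fin d => n)) x))), perRestrict_mem_perSub P _⟩ :
      perSub (𝔸 := 𝔸) (d := d) P) = Ψ u := Subtype.ext (perRestrict_eq_self P hper_u)
  rw [projRPer, hsub, projEPer_eq_projection L k η Λs 1 hτs hτp]
  show rd (RofU (L ^ k) (fun _ : Fin d => n) φ η (fun _ => (1 : 𝔸ˣ)) u) = _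
  rw [hR]
  exact congrArg Subtype.val hmain

end Main

end Literature.MathematicalPhysics.QuantumFieldTheory.Balaban1983to89.B9Eq321RofUReadingZdPer

end
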